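import Literature.AlgebraicGeometry.Motives.AbelianVarietyEquivariantFactorCharacter
import Literature.AlgebraicGeometry.Motives.AbelianVarietyInvariantsGaloisRepresentation
import HarnessLib

/-!
# The `ℓ`-adic character is an invariant of EQUIVARIANT ISOGENY and ADDITIVE on biproducts:
# `charpoly(ρ_X(g) | T_ℓ X) = charpoly(ρ_Y(g) | T_ℓ Y)` for a `G`-isogeny `X → Y`, hence `dim B_H^X = dim B_H^Y` and
# `dim B_W^X = dim B_W^Y` over ANY field; `χ_ℓ^{A ⊞ A'} = χ_ℓ^A + χ_ℓ^{A'}` and `dim B_H^{A ⊞ A'} = dim B_H^A + dim B_H^{A'}`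

Two formal properties of the `ℓ`-adic character `χ_ℓ^X(g) = Tr(T_ℓ ρ(g) | T_ℓ X)` of a finite group acting on an abelian
variety over a field `K` (`ℓ` a prime invertible in `K`), on the ALGEBRAIC carrier `AbelianVariety K`:

§1 INVARIANCE.  If `f : X → Y` is an isogeny intertwining the actions (`ρ_X(g) ≫ f = f ≫ ρ_Y(g)` for all `g`), then
`T_ℓ f : T_ℓ X ↪ T_ℓ Y` is an injective (`IsIsogeny.tateModuleMap_injective`) equivariant map of free `ℤ_ℓ`-modules of the
same rank `2 dim X = 2 dim Y`, so by the LATTICE LEMMA of `Motives/AbelianVarietyInvariantsGaloisRepresentation`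
(`charpoly_eq_of_comp_eq_of_injective_of_finrank_eq`: after `⊗ ℚ_ℓ` the map is an isomorphism — Tate's / Serre–Tate's
"`V_ℓ f` is an isomorphism for an isogeny `f`")

  **`charpoly(T_ℓ ρ_X(g)) = charpoly(T_ℓ ρ_Y(g))`** in `ℤ_ℓ[X]`, hence `χ_ℓ^X = χ_ℓ^Y`,

and by the prequels' dimension formulas (`|H| · 2 dim B_H = Σ_{h ∈ H} χ_ℓ(h)`, `2|G| dim B_W = Σ_g c_W(g) χ_ℓ(g)`) the
Kani–Rosen factors and the isotypical factors of `X` and `Y` have the SAME DIMENSIONS: **`dim B_H^X = dim B_H^Y`** for every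
finite `H ≤ G` and **`dim B_W^X = dim B_W^Y`** for every `W ∈ Irr_ℚ(G)` — over ANY field (the factors are in fact
isogenous; no such isogeny is constructed or needed here).

§2 ADDITIVITY.  For a biproduct `A ⊞ A'` presented by a bicone `b` with `fst ≫ inl + snd ≫ inr = 𝟙` and a BLOCK-DIAGONAL
endomorphism `d` (`inl ≫ d = a ≫ inl`, `inr ≫ d = a' ≫ inr`), `T_ℓ(b.pt) ≅ T_ℓ A × T_ℓ A'` (`T_ℓ` is additive, Mumford §19
p. 176) conjugates `T_ℓ d` to `T_ℓ a × T_ℓ a'`, so `charpoly(T_ℓ d) = charpoly(T_ℓ a) · charpoly(T_ℓ a')` and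
`Tr(T_ℓ d) = Tr(T_ℓ a) + Tr(T_ℓ a')` (the tree had this for the Frobenius only, `IsFrobCharpoly.bicone`); for `G`-actions
`ρ_P` on `b.pt`, `ρ_A`, `ρ_{A'}` making `inl`, `inr` equivariant: **`χ_ℓ^{A ⊞ A'} = χ_ℓ^A + χ_ℓ^{A'}`** and
**`dim B_H^{A ⊞ A'} = dim B_H^A + dim B_H^{A'}`** over ANY field.

## Main statements (sorry-free; theorems only, no new definitions)

* §1 `tateModuleMap_comp_asHom_eq_of_comm` (equivariance of `T_ℓ f`), **`charpoly_tateModuleMap_asHom_eq_of_isIsogeny`**,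
  **`trace_tateModuleMap_asHom_eq_of_isIsogeny`** (`χ_ℓ^X = χ_ℓ^Y`), **`dim_image_norm_eq_of_isIsogeny`** (`dim B_H^X = dim B_H^Y`),
  `dim_image_eq_of_isIsogeny_of_eq_sum_zsmul` (`dim Im(Σ c_g ρ_X(g)) = dim Im(Σ c_g ρ_Y(g))` for quasi-idempotent integral
  combinations), `dim_isotypical_eq_of_isIsogeny` (`dim B_W^X = dim B_W^Y`).
* §2 `comp_fst_eq_of_blockDiagonal`, `comp_snd_eq_of_blockDiagonal`, **`charpoly_tateModuleMap_blockDiagonal`**,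
  **`trace_tateModuleMap_blockDiagonal`**, `trace_tateModuleMap_asHom_biprod_eq_add` (`χ^{A ⊞ A'} = χ^A + χ^{A'}`),
  **`dim_image_norm_biprod_eq_add`** (`dim B_H^{A ⊞ A'} = dim B_H^A + dim B_H^{A'}`).

Scope (stated, not hidden).  `ℓ` invertible in `K` for every `T_ℓ`-statement (the dimension statements choose such an
`ℓ ∈ {2, 3}` internally and hold over any field); isogenies between the factors are not constructed; biproducts enter
as explicit bicone data (no `HasBinaryBiproducts` instance is used).

## References

* [Tate1966Endomorphisms] J. Tate, *Endomorphisms of abelian varieties over finite fields*, Invent. Math. 2 (1966), §1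
  (`V_ℓ f` an isomorphism for an isogeny `f`).
* [SerreTate1968] J.-P. Serre, J. Tate, *Good reduction of abelian varieties*, Ann. Math. 88 (1968), §1 (p. 493).
* [MumfordAV1970] D. Mumford, *Abelian Varieties* (1970), §19 p. 172 (isogenies on `T_ℓ`), Thm. 3 (p. 176, additivity),
  Thm. 4 (p. 180).
* [LangeRodriguez2022] H. Lange, R. E. Rodríguez, *Decomposition of Jacobians by Prym Varieties*, LNM 2310 (2022), §2.9.1
  Thm. 2.9.1, Prop. 2.9.3 (PDF pp. 43, 46); Cor. 2.9.2 (`G`-equivariant isogenies respect the decomposition).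
* [DokchitserEtAl2022] V. Dokchitser, H. Green, A. Konstantinou, A. Morgan, *Parity of ranks of Jacobians of curves*,
  arXiv:2211.06357, §3 (additive functor lemma, `F = V_ℓ`).
* [KaniRosen1989] E. Kani, M. Rosen, *Idempotent relations and factors of Jacobians*, Math. Ann. 284 (1989), §3.
-/

noncomputable section

open CategoryTheory CategoryTheory.Limits
open Literature.RepresentationTheory.FiniteGroups
open Literature.NumberTheory.DiophantineGeometry

universe u

namespace Literature.AlgebraicGeometry.Motives

namespace AbelianVariety

/-! ## §1 Equivariant isogenies preserve the `ℓ`-adic character and the dimensions of all factors -/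

section Isogeny

variable {K : Type u} [Field K] (ℓ : ℕ) [Fact ℓ.Prime] {X Y : AbelianVariety K} {G : Type} [Group G]
  (ρX : G →* End X) (ρY : G →* End Y) {f : X ⟶ Y}

/-- `T_ℓ f ∘ T_ℓ ρ_X(g) = T_ℓ ρ_Y(g) ∘ T_ℓ f` for an equivariant `f` (functoriality of `T_ℓ`). [cite: MumfordAV1970, §19 Thm. 3 (p. 176)] -/
theorem tateModuleMap_comp_asHom_eq_of_comm (hf : ∀ g : G, End.asHom (ρX g) ≫ f = f ≫ End.asHom (ρY g)) (g : G) :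
    tateModuleMap ℓ f ∘ₗ tateModuleMap ℓ (End.asHom (ρX g)) = tateModuleMap ℓ (End.asHom (ρY g)) ∘ₗ tateModuleMap ℓ f := by
  rw [← tateModuleMap_comp, ← tateModuleMap_comp, hf]

/-- **An equivariant isogeny preserves the characteristic polynomials of the action on `T_ℓ`:
`charpoly(T_ℓ ρ_X(g)) = charpoly(T_ℓ ρ_Y(g))` in `ℤ_ℓ[X]`** for every `g ∈ G`, every isogeny `f : X → Y` with
`ρ_X(g) ≫ f = f ≫ ρ_Y(g)` and every prime `ℓ` invertible in `K` — the lattice lemma for the injective equivariant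
`T_ℓ f : T_ℓ X ↪ T_ℓ Y` of equal ranks `2 dim X = 2 dim Y` ("`V_ℓ f` is an isomorphism").
[cite: Tate1966Endomorphisms, §1] [cite: SerreTate1968, §1 (p. 493)] [cite: MumfordAV1970, §19 p. 172] -/
theorem charpoly_tateModuleMap_asHom_eq_of_isIsogeny (hfi : IsIsogeny f)
    (hf : ∀ g : G, End.asHom (ρX g) ≫ f = f ≫ End.asHom (ρY g)) (hℓ : (ℓ : K) ≠ 0) (g : G) :
    haveI := X.module_free_tateModule_holds ℓ hℓ
    haveI := module_finite_tateModule_of_cast_ne_zero X ℓ hℓ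
    haveI := Y.module_free_tateModule_holds ℓ hℓ
    haveI := module_finite_tateModule_of_cast_ne_zero Y ℓ hℓ
    (tateModuleMap ℓ (End.asHom (ρX g))).charpoly = (tateModuleMap ℓ (End.asHom (ρY g))).charpoly := by
  haveI := X.module_free_tateModule_holds ℓ hℓ
  haveI := module_finite_tateModule_of_cast_ne_zero X ℓ hℓ
  haveI := Y.module_free_tateModule_holds ℓ hℓ
  haveI := module_finite_tateModule_of_cast_ne_zero Y ℓ hℓ
  refine charpoly_eq_of_comp_eq_of_injective_of_finrank_eq ℓ (tateModuleMap ℓ f) (hfi.tateModuleMap_injective ℓ) ?_ _ _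
    (tateModuleMap_comp_asHom_eq_of_comm ℓ ρX ρY hf g)
  rw [X.finrank_tateModule_eq_two_mul_dim ℓ hℓ, Y.finrank_tateModule_eq_two_mul_dim ℓ hℓ,
    IsIsogenous.dim_eq ⟨f, hfi⟩]

/-- **The `ℓ`-adic character is an invariant of equivariant isogeny: `χ_ℓ^X(g) = χ_ℓ^Y(g)`**, i.e.
`Tr(T_ℓ ρ_X(g) | T_ℓ X) = Tr(T_ℓ ρ_Y(g) | T_ℓ Y)` for a `G`-isogeny `f : X → Y` (`ℓ` invertible in `K`).
[cite: Tate1966Endomorphisms, §1] [cite: SerreTate1968, §1 (p. 493)] [cite: LangeRodriguez2022, §2.9.1 Cor. 2.9.2 and Prop. 2.9.3] -/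
theorem trace_tateModuleMap_asHom_eq_of_isIsogeny (hfi : IsIsogeny f)
    (hf : ∀ g : G, End.asHom (ρX g) ≫ f = f ≫ End.asHom (ρY g)) (hℓ : (ℓ : K) ≠ 0) (g : G) :
    LinearMap.trace ℤ_[ℓ] (X.tateModule ℓ) (tateModuleMap ℓ (End.asHom (ρX g))) =
      LinearMap.trace ℤ_[ℓ] (Y.tateModule ℓ) (tateModuleMap ℓ (End.asHom (ρY g))) := by
  haveI := X.module_free_tateModule_holds ℓ hℓ
  haveI := module_finite_tateModule_of_cast_ne_zero X ℓ hℓ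
  haveI := Y.module_free_tateModule_holds ℓ hℓ
  haveI := module_finite_tateModule_of_cast_ne_zero Y ℓ hℓ
  rw [trace_eq_neg_nextCoeff_charpoly, trace_eq_neg_nextCoeff_charpoly,
    charpoly_tateModuleMap_asHom_eq_of_isIsogeny ℓ ρX ρY hfi hf hℓ g]

variable {H : Subgroup G} [Fintype H] {NX : X ⟶ X} {NY : Y ⟶ Y}

omit [Fact ℓ.Prime] in
/-- **`dim B_H^X = dim B_H^Y` for a `G`-isogeny `X → Y`, over ANY field**: the Kani–Rosen factors `B_H = Im N_H`
(`N_H^X = Σ_{h ∈ H} ρ_X(h)`, `N_H^Y = Σ_{h ∈ H} ρ_Y(h)`) of equivariantly isogenous abelian varieties have the same dimension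
(`|H| · 2 dim B_H = Σ_{h ∈ H} χ_ℓ(h)` on both sides for a prime `ℓ ∈ {2, 3}` invertible in `K`, and `χ_ℓ^X = χ_ℓ^Y`).
[cite: LangeRodriguez2022, §2.9.1 Cor. 2.9.2 and Prop. 2.9.3 (PDF pp. 43, 46)] [cite: KaniRosen1989, §3] [cite: Tate1966Endomorphisms, §1] -/
theorem dim_image_norm_eq_of_isIsogeny (hfi : IsIsogeny f) (hf : ∀ g : G, End.asHom (ρX g) ≫ f = f ≫ End.asHom (ρY g))
    (hNX : End.of NX = ∑ h : H, ρX h) (hNY : End.of NY = ∑ h : H, ρY h) : (image NX).dim = (image NY).dim := by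
  obtain ⟨l, hlp, hl⟩ := AbelianVariety.exists_prime_natCast_ne_zero K
  haveI : Fact l.Prime := ⟨hlp⟩
  have hX := card_mul_two_mul_dim_image_norm_eq_sum_trace_tateModuleMap l ρX hNX hl
  have hY := card_mul_two_mul_dim_image_norm_eq_sum_trace_tateModuleMap l ρY hNY hl
  simp only [trace_tateModuleMap_asHom_eq_of_isIsogeny l ρX ρY hfi hf hl] at hX
  rw [← hY, Nat.cast_inj] at hX
  have hc : Fintype.card H ≠ 0 := Fintype.card_ne_zero
  have h2 := Nat.eq_of_mul_eq_mul_left (Nat.pos_of_ne_zero hc) hX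
  omega

omit [Fact ℓ.Prime] [Fintype H] in
/-- **Images of matching integral combinations have the same dimension**: if `u_X = Σ_g c_g ρ_X(g)` and
`u_Y = Σ_g c_g ρ_Y(g)` (`c_g ∈ ℤ`, `G` finite) are quasi-idempotents with the same weight `a ≠ 0` (`u² = a u`) and `X → Y`
is a `G`-isogeny, then `dim Im u_X = dim Im u_Y` over ANY field (`a · 2 dim Im u = Σ_g c_g χ_ℓ(g)` on both sides).
[cite: LangeRodriguez2022, §2.9.1 Cor. 2.9.2 and Prop. 2.9.3 (PDF pp. 43, 46)] [cite: Tate1966Endomorphisms, §1] -/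
theorem dim_image_eq_of_isIsogeny_of_eq_sum_zsmul [Fintype G] (hfi : IsIsogeny f)
    (hf : ∀ g : G, End.asHom (ρX g) ≫ f = f ≫ End.asHom (ρY g)) {c : G → ℤ} {uX : X ⟶ X} {uY : Y ⟶ Y} {a : ℕ}
    (ha : a ≠ 0) (huX : uX ≫ uX = a • uX) (huY : uY ≫ uY = a • uY) (hcX : uX = ∑ g, c g • End.asHom (ρX g))
    (hcY : uY = ∑ g, c g • End.asHom (ρY g)) : (image uX).dim = (image uY).dim := by
  obtain ⟨l, hlp, hl⟩ := AbelianVariety.exists_prime_natCast_ne_zero K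
  haveI : Fact l.Prime := ⟨hlp⟩
  have hX := mul_two_mul_dim_image_eq_sum_mul_trace_tateModuleMap l Finset.univ c (fun g ↦ End.asHom (ρX g)) huX hcX hl
  have hY := mul_two_mul_dim_image_eq_sum_mul_trace_tateModuleMap l Finset.univ c (fun g ↦ End.asHom (ρY g)) huY hcY hl
  simp only [trace_tateModuleMap_asHom_eq_of_isIsogeny l ρX ρY hfi hf hl] at hX
  rw [← hY, Nat.cast_inj] at hX
  have h2 := Nat.eq_of_mul_eq_mul_left (Nat.pos_of_ne_zero ha) hX
  omega

omit [Fact ℓ.Prime] [Fintype H] in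
/-- **`dim B_W^X = dim B_W^Y` for a `G`-isogeny `X → Y` and every `W ∈ Irr_ℚ(G)`, over ANY field**: the isotypical factors
`B_W = Im u_W`, `u_W = Σ_g c_W(g) ρ(g)` the integral lift of `|G| e_W` (the tree's `Motives/AbelianVarietyGroupActionIsotypicalDecomposition`,
with the SAME coefficient vectors `c` for `X` and `Y`), have equal dimensions ("a `G`-equivariant isogeny respects the
isotypical decomposition"). [cite: LangeRodriguez2022, §2.9.1 Cor. 2.9.2, Thm. 2.9.1 and Prop. 2.9.3 (PDF pp. 43, 46)]
[cite: Tate1966Endomorphisms, §1] -/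
theorem dim_isotypical_eq_of_isIsogeny [Fintype G] (hfi : IsIsogeny f)
    (hf : ∀ g : G, End.asHom (ρX g) ≫ f = f ≫ End.asHom (ρY g)) {c : ratCharIdempotents G → G → ℤ}
    (hc : ∀ e : ratCharIdempotents G,
      (Fintype.card G : ℚ) • (e : MonoidAlgebra ℚ G) = ∑ g, (c e g : ℚ) • MonoidAlgebra.of ℚ G g)
    {uX : ratCharIdempotents G → (X ⟶ X)} (huX : ∀ e, End.of (uX e) = ∑ g, c e g • ρX g)
    {uY : ratCharIdempotents G → (Y ⟶ Y)} (huY : ∀ e, End.of (uY e) = ∑ g, c e g • ρY g) (e : ratCharIdempotents G) :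
    (image (uX e)).dim = (image (uY e)).dim :=
  dim_image_eq_of_isIsogeny_of_eq_sum_zsmul ρX ρY hfi hf Fintype.card_ne_zero (comp_self_eq_card_nsmul_isotypical ρX hc huX e)
    (comp_self_eq_card_nsmul_isotypical ρY hc huY e) (isotypical_eq_sum_zsmul_asHom ρX huX e)
    (isotypical_eq_sum_zsmul_asHom ρY huY e)

end Isogeny

/-! ## §2 Biproducts: block-diagonal endomorphisms, `χ_ℓ^{A ⊞ A'} = χ_ℓ^A + χ_ℓ^{A'}`, `dim B_H^{A ⊞ A'} = dim B_H^A + dim B_H^{A'}` -/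

section Biproduct

variable {K : Type u} [Field K] (ℓ : ℕ) [Fact ℓ.Prime] {A A' : AbelianVariety K} (b : BinaryBicone A A')
  {d : b.pt ⟶ b.pt} {a : A ⟶ A} {a' : A' ⟶ A'}

/-- A block-diagonal endomorphism commutes with the first projection: `d ≫ fst = fst ≫ a`
(from `inl ≫ d = a ≫ inl`, `inr ≫ d = a' ≫ inr` and `fst ≫ inl + snd ≫ inr = 𝟙`). [cite: MumfordAV1970, §19 Thm. 3 (p. 176)] -/
theorem comp_fst_eq_of_blockDiagonal (hb : b.fst ≫ b.inl + b.snd ≫ b.inr = 𝟙 b.pt) (hinl : b.inl ≫ d = a ≫ b.inl)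
    (hinr : b.inr ≫ d = a' ≫ b.inr) : d ≫ b.fst = b.fst ≫ a := by
  calc d ≫ b.fst = (b.fst ≫ b.inl + b.snd ≫ b.inr) ≫ d ≫ b.fst := by rw [hb, Category.id_comp]
    _ = b.fst ≫ (b.inl ≫ d) ≫ b.fst + b.snd ≫ (b.inr ≫ d) ≫ b.fst := by
        simp only [Preadditive.add_comp, Category.assoc]
    _ = b.fst ≫ a := by
        rw [hinl, hinr, Category.assoc, Category.assoc, b.inl_fst, b.inr_fst, Category.comp_id, comp_zero, comp_zero,
          add_zero]

/-- A block-diagonal endomorphism commutes with the second projection: `d ≫ snd = snd ≫ a'`. [cite: MumfordAV1970, §19 Thm. 3 (p. 176)] -/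
theorem comp_snd_eq_of_blockDiagonal (hb : b.fst ≫ b.inl + b.snd ≫ b.inr = 𝟙 b.pt) (hinl : b.inl ≫ d = a ≫ b.inl)
    (hinr : b.inr ≫ d = a' ≫ b.inr) : d ≫ b.snd = b.snd ≫ a' := by
  calc d ≫ b.snd = (b.fst ≫ b.inl + b.snd ≫ b.inr) ≫ d ≫ b.snd := by rw [hb, Category.id_comp]
    _ = b.fst ≫ (b.inl ≫ d) ≫ b.snd + b.snd ≫ (b.inr ≫ d) ≫ b.snd := by
        simp only [Preadditive.add_comp, Category.assoc]
    _ = b.snd ≫ a' := by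
        rw [hinl, hinr, Category.assoc, Category.assoc, b.inl_snd, b.inr_snd, Category.comp_id, comp_zero, comp_zero,
          zero_add]

/-- **`T_ℓ` of a block-diagonal endomorphism is conjugate to `T_ℓ a × T_ℓ a'`**: along
`(T_ℓ fst, T_ℓ snd) : T_ℓ(b.pt) ≅ T_ℓ A × T_ℓ A'` one has `charpoly(T_ℓ d) = charpoly(T_ℓ a) · charpoly(T_ℓ a')` (instance
form; the tree's `IsFrobCharpoly.bicone` is the case `d, a, a' = π`). [cite: MumfordAV1970, §19 Thm. 3 (p. 176: `T_ℓ` is additive) and Thm. 4 (p. 180)] -/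
theorem charpoly_tateModuleMap_blockDiagonal (hb : b.fst ≫ b.inl + b.snd ≫ b.inr = 𝟙 b.pt) (hinl : b.inl ≫ d = a ≫ b.inl)
    (hinr : b.inr ≫ d = a' ≫ b.inr)
    [Module.Free ℤ_[ℓ] (A.tateModule ℓ)] [Module.Finite ℤ_[ℓ] (A.tateModule ℓ)]
    [Module.Free ℤ_[ℓ] (A'.tateModule ℓ)] [Module.Finite ℤ_[ℓ] (A'.tateModule ℓ)]
    [Module.Free ℤ_[ℓ] (b.pt.tateModule ℓ)] [Module.Finite ℤ_[ℓ] (b.pt.tateModule ℓ)] :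
    (tateModuleMap ℓ d).charpoly = (tateModuleMap ℓ a).charpoly * (tateModuleMap ℓ a').charpoly := by
  -- the pointwise bicone identities on Tate modules
  have h11 := fun x ↦ LinearMap.congr_fun (tateModuleMap_bicone_inl_fst ℓ b) x
  have h12 := fun x ↦ LinearMap.congr_fun (tateModuleMap_bicone_inr_fst ℓ b) x
  have h21 := fun x ↦ LinearMap.congr_fun (tateModuleMap_bicone_inl_snd ℓ b) x
  have h22 := fun x ↦ LinearMap.congr_fun (tateModuleMap_bicone_inr_snd ℓ b) x
  have htot := fun x ↦ LinearMap.congr_fun (tateModuleMap_bicone_total ℓ b hb) x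
  simp only [LinearMap.comp_apply, LinearMap.id_apply, LinearMap.zero_apply, LinearMap.add_apply] at h11 h12 h21 h22 htot
  -- `T_ℓ(b.pt) ≅ T_ℓ A × T_ℓ A'`
  let e : b.pt.tateModule ℓ ≃ₗ[ℤ_[ℓ]] A.tateModule ℓ × A'.tateModule ℓ :=
    LinearEquiv.ofLinear ((tateModuleMap ℓ b.fst).prod (tateModuleMap ℓ b.snd))
      ((tateModuleMap ℓ b.inl).coprod (tateModuleMap ℓ b.inr))
      (by
        apply LinearMap.ext
        rintro ⟨x, x'⟩
        simp only [LinearMap.comp_apply, LinearMap.coprod_apply, map_add, LinearMap.id_apply, LinearMap.prod_apply,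
          Function.prod, h11, h12, h21, h22, Prod.mk_add_mk, add_zero, zero_add])
      (by
        apply LinearMap.ext
        intro x
        simpa only [LinearMap.comp_apply, LinearMap.coprod_apply, LinearMap.prod_apply, Function.prod,
          LinearMap.id_apply] using htot x)
  -- `d` against the projections
  have hfst : (tateModuleMap ℓ b.fst).comp (tateModuleMap ℓ d) = (tateModuleMap ℓ a).comp (tateModuleMap ℓ b.fst) := by
    rw [← tateModuleMap_comp, ← tateModuleMap_comp, comp_fst_eq_of_blockDiagonal b hb hinl hinr]
  have hsnd : (tateModuleMap ℓ b.snd).comp (tateModuleMap ℓ d) = (tateModuleMap ℓ a').comp (tateModuleMap ℓ b.snd) := by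
    rw [← tateModuleMap_comp, ← tateModuleMap_comp, comp_snd_eq_of_blockDiagonal b hb hinl hinr]
  have hcomm : ∀ x, e (tateModuleMap ℓ d x) = ((tateModuleMap ℓ a).prodMap (tateModuleMap ℓ a')) (e x) := by
    intro x
    have h1 := LinearMap.congr_fun hfst x
    have h2 := LinearMap.congr_fun hsnd x
    simp only [LinearMap.comp_apply] at h1 h2
    simp only [e, LinearEquiv.ofLinear_apply, LinearMap.prod_apply, Function.prod, LinearMap.prodMap_apply, h1, h2]
  have key : e.conj (tateModuleMap ℓ d) = (tateModuleMap ℓ a).prodMap (tateModuleMap ℓ a') := by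
    apply LinearMap.ext
    intro y
    have h := hcomm (e.symm y)
    rw [LinearEquiv.apply_symm_apply] at h
    simpa only [LinearEquiv.conj_apply, LinearMap.comp_apply, LinearEquiv.coe_coe] using h
  rw [← LinearEquiv.charpoly_conj e, key, LinearMap.charpoly_prodMap]

/-- **`Tr(T_ℓ d) = Tr(T_ℓ a) + Tr(T_ℓ a')`** for a block-diagonal endomorphism `d = a ⊕ a'` of `A ⊞ A'` (`ℓ` invertible in `K`).
[cite: MumfordAV1970, §19 Thm. 3 (p. 176) and Thm. 4 (p. 180)] -/
theorem trace_tateModuleMap_blockDiagonal (hb : b.fst ≫ b.inl + b.snd ≫ b.inr = 𝟙 b.pt) (hinl : b.inl ≫ d = a ≫ b.inl)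
    (hinr : b.inr ≫ d = a' ≫ b.inr) (hℓ : (ℓ : K) ≠ 0) :
    LinearMap.trace ℤ_[ℓ] (b.pt.tateModule ℓ) (tateModuleMap ℓ d) =
      LinearMap.trace ℤ_[ℓ] (A.tateModule ℓ) (tateModuleMap ℓ a) + LinearMap.trace ℤ_[ℓ] (A'.tateModule ℓ) (tateModuleMap ℓ a') := by
  haveI := A.module_free_tateModule_holds ℓ hℓ
  haveI := module_finite_tateModule_of_cast_ne_zero A ℓ hℓ
  haveI := A'.module_free_tateModule_holds ℓ hℓ
  haveI := module_finite_tateModule_of_cast_ne_zero A' ℓ hℓ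
  haveI := b.pt.module_free_tateModule_holds ℓ hℓ
  haveI := module_finite_tateModule_of_cast_ne_zero b.pt ℓ hℓ
  have hA := A.finrank_tateModule_eq_two_mul_dim ℓ hℓ
  have hA' := A'.finrank_tateModule_eq_two_mul_dim ℓ hℓ
  have hP := b.pt.finrank_tateModule_eq_two_mul_dim ℓ hℓ
  -- traces are `-nextCoeff` of the characteristic polynomials, which multiply
  rw [trace_eq_neg_nextCoeff_charpoly, trace_eq_neg_nextCoeff_charpoly, trace_eq_neg_nextCoeff_charpoly,
    charpoly_tateModuleMap_blockDiagonal ℓ b hb hinl hinr,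
    (LinearMap.charpoly_monic _).nextCoeff_mul (LinearMap.charpoly_monic _), neg_add]

variable {G : Type} [Group G] (ρP : G →* End b.pt) (ρA : G →* End A) (ρA' : G →* End A')

/-- **`χ_ℓ^{A ⊞ A'} = χ_ℓ^A + χ_ℓ^{A'}`**: for actions `ρ_P` on the biproduct and `ρ_A`, `ρ_{A'}` on the factors making the
injections `inl`, `inr` equivariant, `Tr(T_ℓ ρ_P(g)) = Tr(T_ℓ ρ_A(g)) + Tr(T_ℓ ρ_{A'}(g))` for every `g` (`ℓ` invertible in `K`).
[cite: MumfordAV1970, §19 Thm. 3 (p. 176)] [cite: LangeRodriguez2022, §2.9.1 Prop. 2.9.3, proof (PDF p. 46)] -/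
theorem trace_tateModuleMap_asHom_biprod_eq_add (hb : b.fst ≫ b.inl + b.snd ≫ b.inr = 𝟙 b.pt)
    (hinl : ∀ g : G, b.inl ≫ End.asHom (ρP g) = End.asHom (ρA g) ≫ b.inl)
    (hinr : ∀ g : G, b.inr ≫ End.asHom (ρP g) = End.asHom (ρA' g) ≫ b.inr) (hℓ : (ℓ : K) ≠ 0) (g : G) :
    LinearMap.trace ℤ_[ℓ] (b.pt.tateModule ℓ) (tateModuleMap ℓ (End.asHom (ρP g))) =
      LinearMap.trace ℤ_[ℓ] (A.tateModule ℓ) (tateModuleMap ℓ (End.asHom (ρA g))) +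
        LinearMap.trace ℤ_[ℓ] (A'.tateModule ℓ) (tateModuleMap ℓ (End.asHom (ρA' g))) :=
  trace_tateModuleMap_blockDiagonal ℓ b hb (hinl g) (hinr g) hℓ

variable {H : Subgroup G} [Fintype H] {NP : b.pt ⟶ b.pt} {NA : A ⟶ A} {NA' : A' ⟶ A'}

omit [Fact ℓ.Prime] in
/-- **`dim B_H^{A ⊞ A'} = dim B_H^A + dim B_H^{A'}` over ANY field**: the Kani–Rosen factors `B_H = Im N_H` of a biproduct
with the product action (injections equivariant) have additive dimensions (`|H| · 2 dim B_H = Σ_{h ∈ H} χ_ℓ(h)` and §2's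
additivity of `χ_ℓ`, for a prime `ℓ ∈ {2, 3}` invertible in `K`). [cite: LangeRodriguez2022, §2.9.1 Prop. 2.9.3, proof (PDF p. 46)]
[cite: KaniRosen1989, §3] [cite: MumfordAV1970, §19 Thm. 3 (p. 176)] -/
theorem dim_image_norm_biprod_eq_add (hb : b.fst ≫ b.inl + b.snd ≫ b.inr = 𝟙 b.pt)
    (hinl : ∀ g : G, b.inl ≫ End.asHom (ρP g) = End.asHom (ρA g) ≫ b.inl)
    (hinr : ∀ g : G, b.inr ≫ End.asHom (ρP g) = End.asHom (ρA' g) ≫ b.inr)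
    (hNP : End.of NP = ∑ h : H, ρP h) (hNA : End.of NA = ∑ h : H, ρA h) (hNA' : End.of NA' = ∑ h : H, ρA' h) :
    (image NP).dim = (image NA).dim + (image NA').dim := by
  obtain ⟨l, hlp, hl⟩ := AbelianVariety.exists_prime_natCast_ne_zero K
  haveI : Fact l.Prime := ⟨hlp⟩
  have hP := card_mul_two_mul_dim_image_norm_eq_sum_trace_tateModuleMap l ρP hNP hl
  have hA := card_mul_two_mul_dim_image_norm_eq_sum_trace_tateModuleMap l ρA hNA hl
  have hA' := card_mul_two_mul_dim_image_norm_eq_sum_trace_tateModuleMap l ρA' hNA' hl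
  simp only [trace_tateModuleMap_asHom_biprod_eq_add l b ρP ρA ρA' hb hinl hinr hl, Finset.sum_add_distrib] at hP
  rw [← hA, ← hA', ← Nat.cast_add, Nat.cast_inj] at hP
  have hc : Fintype.card H ≠ 0 := Fintype.card_ne_zero
  have h2 : Fintype.card H * (2 * (image NP).dim) = Fintype.card H * (2 * ((image NA).dim + (image NA').dim)) := by
    rw [hP]; ring
  have h3 := Nat.eq_of_mul_eq_mul_left (Nat.pos_of_ne_zero hc) h2
  omega

end Biproduct

end AbelianVariety

end Literature.AlgebraicGeometry.Motives
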